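import Summits.ResolutionOfSingularities.ResolutionOfSingularities.Theorems.MarkedTransferCampaignW46WWalkStep
import Summits.ResolutionOfSingularities.ResolutionOfSingularities.Theorems.MarkedTransferCampaignW46WWalkPoint
import Summits.ResolutionOfSingularities.ResolutionOfSingularities.Theorems.MarkedTransferCampaignW46WWalkClean
import Summits.ResolutionOfSingularities.ResolutionOfSingularities.Theorems.MarkedTransferCampaignW46MohWindowShadeFormalInsepWalk
import Summits.ResolutionOfSingularities.ResolutionOfSingularities.Theorems.MarkedTransferCampaignW46MohWindowSurfaceHeavyInsep
import Literature.AlgebraicGeometry.Resolution.RegularLocalRingsProofs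
import Summits.ResolutionOfSingularities.ResolutionOfSingularities.Theorems.MarkedTransferCampaignW46ApproximateExit
import HarnessLib

/-!
# [OURS · L1 W4.6 rung (iii-2)] THE W-WALK: ONE STEP ALONG A HIT THREAD — the `w`-anchor, the boundary letters and the cleaned
# residual are carried to the next stage, with the model step data `(v, l, γ)` at a hit

Cell `res-hironaka`, LADDER-RESOLUTION rung L (D-0089), slot W4.6 rung (iii); seat res-L1-s46-pv-5 (gen 6), plan
`HOME/L/res-L1-s46-pv-5/W-WALK-PLAN.md` §5 (F3/F5). Host route MarkedTransfer, `--supports stmt-ResolutionOfSingularities-16155 --as helper`;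
kind proof (def-free). Template: res-L1-s46-pv-6 `…FormalInsepWalk.formalInsepAnchor_succ`.

WHAT. `wAnchor_succ`: along a hit thread of a permissible run inside o1's regime `regimeMohWindowSurfaceInsep` (thread points residually
rational over their images), a `w`-anchor `e(f₀) = w · (z^p + f)` of `J_k` at `y_k` with `ord f ≥ p + 1` and `BDiv r_t r_y f` yields one at
`y_{k+1}` for `J_{k+1}` with residual `f′`: at a HIT stage `f′ = stepT p l γ f` (a `T`-step, boundary `(d − p, r_y or 0)`) or
`f′ = stepT p 0 γ (swapTY f)` (the sharp-vertical step, boundary `(d − p, r_t)`), `d = ord f`, with the cleaning root `γ` read off o1's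
presentation at the child (`…WWalkPoint.cleaningData_of_wAnchor`) and `γ = 0` whenever the kept letter is present; off the centre `f′ = f`.

HONEST FRAMING. OURS; nothing here is a statement of H. Hironaka's manuscript [Hironaka2017] and nothing of it is used. AI-written;
AI review is weaker than expert review. No `sorry`; axioms standard. [cite: StacksProject, Tag 0804] [cite: Matsumura1987, Thm. 8.11]
-/

noncomputable section

set_option linter.dupNamespace false -- mandated namespace of this single-conjunct summit

open MvPowerSeries IsLocalRing Finset
open Literature.AlgebraicGeometry.Resolution
open Literature.RingTheory.MvPowerSeries.Jets (mem_maximalIdeal_iff_constantCoeff_eq_zero mem_maximalIdeal_pow_iff)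

namespace Summit.ResolutionOfSingularities.ResolutionOfSingularities.Theorems

namespace CampaignW46

namespace WWalk

open CategoryTheory AlgebraicGeometry TopologicalSpace
open Literature.AlgebraicGeometry.Hironaka2017.S02Preliminaries
open Literature.AlgebraicGeometry.Hironaka2017.Datum
open Scheme.IdealSheafData
open CampaignW46.FormalChart (ringEquiv_mem_maximalIdeal ringEquiv_mem_maximalIdeal_pow)
open CampaignW46.AtomGerm (mem_maximalIdeal_pow_iff_algebraMap)
open MohWindowShadeFormalStep (exists_formalAnchor_offCentre)

variable {p : ℕ} [hp : Fact p.Prime] {K : Type} [Field K] [CharP K p]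

/-- o1's coefficient presentation at a singular point of a state of the regime. [folklore] -/
theorem coeffAt_of_regime {A : AmbientDatum p K} {E : IdealExponent A.Z} (hRg : regimeMohWindowSurfaceInsep (p := p) (K := K) A E)
    {ξ : A.Z} (hξ : ξ ∈ E.sing) : MohWindowSurfaceCoeffAt p (A.Z.presheaf.stalk ξ) (stalkIdeal E.J ξ) := by
  obtain ⟨hb, -, -, hcoeff⟩ := (regimeMohWindowSurfaceInsep_iff_mohWindowSurface A E).mp hRg
  have h := hcoeff ξ hξ
  rwa [hb] at h

/-- The residual of a `w`-anchor at a point of the regime: `f ≠ 0`, `p + 1 ≤ ord f ≤ 2p − 1` (as a natural number `d`), `LowVanish d f`,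
a monomial of degree `d`, and (ND) when the shade is `< p`. [folklore] -/
theorem residual_facts {A : AmbientDatum p K} {E : IdealExponent A.Z} (hRg : regimeMohWindowSurfaceInsep (p := p) (K := K) A E)
    {ξ : A.Z} (hξ : ξ ∈ E.sing)
    (e : AdicCompletion (maximalIdeal (A.Z.presheaf.stalk ξ)) (A.Z.presheaf.stalk ξ) ≃+* MvPowerSeries (Option (Fin 2)) K)
    {f₀ : A.Z.presheaf.stalk ξ} (hJ : stalkIdeal E.J ξ = Ideal.span {f₀}) {w : MvPowerSeries (Option (Fin 2)) K} (hw : IsUnit w)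
    {f : MvPowerSeries (Option (Fin 2)) K} (hE : e (algebraMap _ _ f₀) = w * (X none ^ p + f)) (hfP2 : LowVanish (p + 1) f)
    {rt ry : ℕ} (hB : BDiv rt ry f) :
    ∃ d : ℕ, f.order = d ∧ p + 1 ≤ d ∧ d ≤ 2 * p - 1 ∧ LowVanish d f ∧ (∃ a b c, a + b + c = d ∧ coeff (mk3 a b c) f ≠ 0) ∧
      (d - rt - ry < p → NDz d f) := by
  classical
  obtain ⟨hR, -, -, -, -⟩ := MohWindowShadeAnchorWalk.regime_point hRg hξ
  haveI := hR
  haveI : IsDomain (A.Z.presheaf.stalk ξ) := isDomain_of_isRegularLocalRing _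
  obtain ⟨d₂, hd₂, hd₂', hvan, a₀, b₀, hab₀, hne₀⟩ := window_and_ndz_of_wAnchor (coeffAt_of_regime hRg hξ) e hJ hw hE hfP2
  -- the order of `f` is finite and in the window
  have hle : f.order ≤ d₂ := by
    have := MvPowerSeries.order_le (f := f) hne₀
    rwa [degree_mk3, hab₀] at this
  have hge : ((p + 1 : ℕ) : ℕ∞) ≤ f.order := MvPowerSeries.nat_le_order fun e he => hfP2 e (by exact_mod_cast he)
  obtain ⟨d, hd⟩ : ∃ d : ℕ, f.order = d := by
    have : f.order ≠ ⊤ := by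
      intro h; rw [h] at hle; exact absurd hle (by simp)
    exact ENat.ne_top_iff_exists.mp this |>.imp fun d h => h.symm
  have hpd : p + 1 ≤ d := by rw [hd] at hge; exact_mod_cast hge
  have hdd₂ : d ≤ d₂ := by rw [hd] at hle; exact_mod_cast hle
  have hlow : LowVanish d f := fun e he => MvPowerSeries.coeff_of_lt_order (by rw [hd]; exact_mod_cast he)
  have hex : ∃ a b c, a + b + c = d ∧ coeff (mk3 a b c) f ≠ 0 := by
    obtain ⟨⟨e', he', hdeg⟩, -⟩ := (MvPowerSeries.order_eq_nat (f := f) (n := d)).mp hd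
    refine ⟨e' (some 0), e' (some 1), e' none, by rw [← degree_eq]; exact hdeg, by rw [mk3_eta]; exact he'⟩
  refine ⟨d, hd, hpd, by omega, hlow, hex, fun hσ => ?_⟩
  -- (ND): the degree-`d` witness has `z`-exponent `≤ σ < p`, so `d = d₂`
  obtain ⟨a, b, c, habc, hne⟩ := hex
  have hbd := hB _ hne
  simp only [mk3_t, mk3_y] at hbd
  have hcp : c < p := by omega
  have hdeq : d = d₂ := by
    by_contra hne'
    exact hne (hvan a b c (by omega) hcp)
  rw [hdeq]
  exact ⟨a₀, b₀, hab₀, hne₀⟩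

/-- The boundary exponents of a `w`-anchor are `< p` (the approximate exit door in the completion). [folklore] -/
theorem bdiv_lt_of_wAnchor [PerfectField K] {A : AmbientDatum p K} {E : IdealExponent A.Z} (hRg : regimeMohWindowSurfaceInsep (p := p) (K := K) A E)
    {ξ : A.Z} (e : AdicCompletion (maximalIdeal (A.Z.presheaf.stalk ξ)) (A.Z.presheaf.stalk ξ) ≃+* MvPowerSeries (Option (Fin 2)) K)
    {f₀ : A.Z.presheaf.stalk ξ} (hJ : stalkIdeal E.J ξ = Ideal.span {f₀}) {w : MvPowerSeries (Option (Fin 2)) K}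
    {f : MvPowerSeries (Option (Fin 2)) K} (hE : e (algebraMap _ _ f₀) = w * (X none ^ p + f)) {rt ry : ℕ} (hB : BDiv rt ry f) :
    rt < p ∧ ry < p := by
  classical
  obtain ⟨⟨⟨-, hcl⟩, -⟩, hb⟩ := (regimeMohWindowSurfaceInsep_iff A E).mp hRg
  obtain ⟨N, hN⟩ := exists_forall_not_map_le_span_pair_pow_sup_mvPowerSeries A E hcl (by rw [hb]; exact hp.out.pos) ξ e
  rw [hb] at hN
  -- the image ideal is generated by `w (z^p + f)`
  have hmap : (stalkIdeal E.J ξ).map ((e : AdicCompletion (maximalIdeal (A.Z.presheaf.stalk ξ)) (A.Z.presheaf.stalk ξ) →+*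
      MvPowerSeries (Option (Fin 2)) K).comp (algebraMap (A.Z.presheaf.stalk ξ) (AdicCompletion (maximalIdeal (A.Z.presheaf.stalk ξ)) (A.Z.presheaf.stalk ξ)))) =
      Ideal.span {w * (X none ^ p + f)} := by
    rw [hJ, Ideal.map_span, Set.image_singleton, RingHom.comp_apply]
    change Ideal.span {e (algebraMap _ _ f₀)} = _
    rw [hE]
  have key : ∀ i : Option (Fin 2), i ≠ none → (∀ e', coeff e' f ≠ 0 → p ≤ e' i) → False := by
    intro i hi hdiv
    apply hN (X none) (X i) (mem_maximalIdeal_iff_constantCoeff_eq_zero.mpr (constantCoeff_X _))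
      (mem_maximalIdeal_iff_constantCoeff_eq_zero.mpr (constantCoeff_X _))
    rw [hmap, Ideal.span_singleton_le_iff_mem]
    refine Ideal.mem_sup_left (Ideal.mul_mem_left _ _ (Ideal.add_mem _ ?_ ?_))
    · exact Ideal.pow_mem_pow (Ideal.subset_span (Set.mem_insert _ _)) p
    · -- `f ∈ (X i)^p ⊆ (X none, X i)^p`
      have hdvd : (X i : MvPowerSeries (Option (Fin 2)) K) ^ p ∣ f :=
        (MvPowerSeries.X_pow_dvd_iff).mpr fun m hm => by by_contra h; exact absurd (hdiv m h) (by omega)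
      obtain ⟨q, hq⟩ := hdvd
      rw [hq]
      exact Ideal.mul_mem_right _ _ (Ideal.pow_mem_pow (Ideal.subset_span (Set.mem_insert_of_mem _ (Set.mem_singleton _))) p)
  constructor
  · by_contra h
    push Not at h
    exact key (some 0) (Option.some_ne_none 0) fun e' he' => h.trans (hB e' he').1
  · by_contra h
    push Not at h
    exact key (some 1) (Option.some_ne_none 1) fun e' he' => h.trans (hB e' he').2

/-- **ONE STEP ALONG A HIT THREAD, `w`-anchors.** See the module docstring. [cite: StacksProject, Tag 0804] [cite: Matsumura1987, Thm. 8.11] -/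
theorem wAnchor_succ [DecidableEq K] (r : PermissibleRun p K) (hr : ∀ k, regimeMohWindowSurfaceInsep (p := p) (K := K) (r.A k) (r.E k))
    (t : r.HitThread) (k : ℕ)
    (hrat : ∀ y : (r.A (k + 1)).Z.presheaf.stalk (t.y (k + 1)), ∃ x : (r.A k).Z.presheaf.stalk ((r.π k).base (t.y (k + 1))),
      y - ((r.π k).stalkMap (t.y (k + 1))).hom x ∈ maximalIdeal _)
    (f : MvPowerSeries (Option (Fin 2)) K) (rt ry : ℕ)
    (hA : ∃ (e : AdicCompletion (maximalIdeal ((r.A k).Z.presheaf.stalk (t.y k))) ((r.A k).Z.presheaf.stalk (t.y k)) ≃+*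
        MvPowerSeries (Option (Fin 2)) K) (f₀ : (r.A k).Z.presheaf.stalk (t.y k)) (w : MvPowerSeries (Option (Fin 2)) K),
      stalkIdeal (r.E k).J (t.y k) = Ideal.span {f₀} ∧ IsUnit w ∧ e (algebraMap _ _ f₀) = w * (X none ^ p + f))
    (hP2 : LowVanish (p + 1) f) (hB : BDiv rt ry f) :
    ∃ (f' : MvPowerSeries (Option (Fin 2)) K) (rt' ry' : ℕ) (v : Bool) (l γ : K),
      ((r.D k : Set (r.A k).Z) = {t.y k} →
        (v = false → f' = stepT p l γ f ∧ rt' = f.order.toNat - p ∧ ry' = (if l = 0 then ry else 0) ∧ (l = 0 → 0 < ry → γ = 0)) ∧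
        (v = true → f' = stepT p 0 γ (swapTY f) ∧ rt' = f.order.toNat - p ∧ ry' = rt ∧ (0 < rt → γ = 0))) ∧
      ((r.D k : Set (r.A k).Z) ≠ {t.y k} → f' = f ∧ rt' = rt ∧ ry' = ry) ∧
      (∃ (e : AdicCompletion (maximalIdeal ((r.A (k + 1)).Z.presheaf.stalk (t.y (k + 1)))) ((r.A (k + 1)).Z.presheaf.stalk (t.y (k + 1))) ≃+*
          MvPowerSeries (Option (Fin 2)) K) (f₀ : (r.A (k + 1)).Z.presheaf.stalk (t.y (k + 1))) (w : MvPowerSeries (Option (Fin 2)) K),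
        stalkIdeal (r.E (k + 1)).J (t.y (k + 1)) = Ideal.span {f₀} ∧ IsUnit w ∧ e (algebraMap _ _ f₀) = w * (X none ^ p + f')) ∧
      LowVanish (p + 1) f' ∧ BDiv rt' ry' f' := by
  classical
  have hc := t.compat k
  have hmem : (r.π k).base (t.y (k + 1)) ∈ (r.E k).sing := by rw [hc]; exact t.mem k
  obtain ⟨hR, h3, hcl, -, hb⟩ := MohWindowShadeAnchorWalk.regime_point (hr k) hmem
  haveI := hR
  have hA' : ∃ (e : AdicCompletion (maximalIdeal ((r.A k).Z.presheaf.stalk ((r.π k).base (t.y (k + 1)))))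
        ((r.A k).Z.presheaf.stalk ((r.π k).base (t.y (k + 1)))) ≃+* MvPowerSeries (Option (Fin 2)) K)
      (f₀ : (r.A k).Z.presheaf.stalk ((r.π k).base (t.y (k + 1)))) (w : MvPowerSeries (Option (Fin 2)) K),
      stalkIdeal (r.E k).J ((r.π k).base (t.y (k + 1))) = Ideal.span {f₀} ∧ IsUnit w ∧
        e (algebraMap _ _ f₀) = w * (X none ^ p + f) := by
    rw [hc]; exact hA
  obtain ⟨e, f₀, w, hJ, hw, hE⟩ := hA'
  -- the parent's window: `d = ord f ∈ [p+1, 2p−1]`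
  obtain ⟨d, hd, hpd, hd2, hlowd, -, -⟩ := residual_facts (hr k) hmem e hJ hw hE hP2 hB
  have hdto : f.order.toNat = d := by rw [hd]; rfl
  have hsing' : t.y (k + 1) ∈ ((r.E k).transform (r.π k) (r.D k)).sing := by
    have := t.mem (k + 1); rwa [r.E_succ k] at this
  -- the child's regime data
  obtain ⟨hR', -, -, -, hb'⟩ := MohWindowShadeAnchorWalk.regime_point (hr (k + 1)) (t.mem (k + 1))
  haveI := hR'
  haveI : IsDomain ((r.A (k + 1)).Z.presheaf.stalk (t.y (k + 1))) := isDomain_of_isRegularLocalRing _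
  have hcoeff' : MohWindowSurfaceCoeffAt p ((r.A (k + 1)).Z.presheaf.stalk (t.y (k + 1))) (stalkIdeal (r.E (k + 1)).J (t.y (k + 1))) :=
    coeffAt_of_regime (hr (k + 1)) (t.mem (k + 1))
  by_cases hhit : (r.D k : Set (r.A k).Z) = {t.y k}
  · -- the thread point is blown up: a model step
    have hD : (r.D k : Set (r.A k).Z) = {(r.π k).base (t.y (k + 1))} := by rw [hc]; exact hhit
    obtain ⟨E', f', w', hJ', hw', hcase⟩ :=
      exists_wAnchor_step (r.π k) (r.D k) (r.blowup k) hb hD hmem hsing' h3 hrat e hJ hw f hP2 hE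
    have hJ'' : stalkIdeal (r.E (k + 1)).J (t.y (k + 1)) = Ideal.span {f'} := by rw [r.E_succ k]; exact hJ'
    -- `f' ∈ 𝔪^p`, so the uncleaned residual has order `≥ p`
    have hf'𝔪 : f' ∈ maximalIdeal ((r.A (k + 1)).Z.presheaf.stalk (t.y (k + 1))) ^ p := by
      have h := (le_idealOrder_iff (r.E (k + 1)).J (t.y (k + 1)) (r.E (k + 1)).b).mp (t.mem (k + 1))
      rw [hJ'', Ideal.span_singleton_le_iff_mem, hb'] at h
      exact h
    have lowp : ∀ {f₁ : MvPowerSeries (Option (Fin 2)) K} {w₁ : MvPowerSeries (Option (Fin 2)) K}, IsUnit w₁ →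
        E' (algebraMap _ _ f') = w₁ * (X none ^ p + f₁) → LowVanish p f₁ := by
      intro f₁ w₁ hw₁ hE₁
      have h1 : w₁ * (X none ^ p + f₁) ∈ maximalIdeal (MvPowerSeries (Option (Fin 2)) K) ^ p := by
        rw [← hE₁]; exact ringEquiv_mem_maximalIdeal_pow E' ((mem_maximalIdeal_pow_iff_algebraMap p f').mp hf'𝔪)
      have h2 : X none ^ p + f₁ ∈ maximalIdeal (MvPowerSeries (Option (Fin 2)) K) ^ p := (Ideal.unit_mul_mem_iff_mem _ hw₁).mp h1
      have h3 : f₁ ∈ maximalIdeal (MvPowerSeries (Option (Fin 2)) K) ^ p := by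
        have : f₁ = (X none ^ p + f₁) - X none ^ p := by ring
        rw [this]
        exact Ideal.sub_mem _ h2 (Ideal.pow_mem_pow (mem_maximalIdeal_iff_constantCoeff_eq_zero.mpr (constantCoeff_X _)) p)
      exact mem_maximalIdeal_pow_iff.mp h3
    rcases hcase with ⟨l, hE'⟩ | hE'
    · -- `T`-step at `(1 : l : 0)`
      have hlow₁ := lowp hw' hE'
      obtain ⟨hdeg, β', hβ'⟩ := cleaningData_of_wAnchor hcoeff' E' hJ'' hw' hE' (coeff_chartT_texp_zero hP2 0 p)
        (coeff_chartT_texp_zero hP2 p 0)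
      obtain ⟨E'', w'', hw'', hE''⟩ := exists_ringEquiv_clean E' (algebraMap _ _ f') w' hw' l β' f hE'
      have hγ0 : l = 0 → 0 < ry → β' = 0 := by
        intro hl hry
        have h0 : coeff (mk3 p 0 0) (chartT p l f) = 0 := by rw [hl]; exact coeff_chartT_eq_zero_of_lt_ry hB hry
        rw [h0] at hβ'
        exact (pow_eq_zero_iff hp.out.ne_zero).mp hβ'.symm
      refine ⟨stepT p l β' f, d - p, if l = 0 then ry else 0, false, l, β', fun _ => ⟨fun _ => ⟨rfl, by rw [hdto], rfl, hγ0⟩,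
        fun h => absurd h (by decide)⟩, fun h => absurd hhit h, ⟨E'', f', w'', hJ'', hw'', hE''⟩,
        lowVanish_succ_stepT hlow₁ hdeg hβ', ?_⟩
      exact bdiv_stepT hlowd hB hpd (by omega) hγ0
    · -- sharp-vertical step at `(0 : 1 : 0)`
      have hlow₁ := lowp hw' hE'
      have hP2s : LowVanish (p + 1) (swapTY f) := lowVanish_swapTY hP2
      have hBs : BDiv ry rt (swapTY f) := bdiv_swapTY hB
      obtain ⟨hdeg, β', hβ'⟩ := cleaningData_of_wAnchor hcoeff' E' hJ'' hw' hE' (coeff_chartT_texp_zero hP2s 0 p)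
        (coeff_chartT_texp_zero hP2s p 0)
      obtain ⟨E'', w'', hw'', hE''⟩ := exists_ringEquiv_clean E' (algebraMap _ _ f') w' hw' 0 β' (swapTY f) hE'
      have hγ0 : (0 : K) = 0 → 0 < rt → β' = 0 := by
        intro _ hrt
        have h0 : coeff (mk3 p 0 0) (chartT p (0 : K) (swapTY f)) = 0 := coeff_chartT_eq_zero_of_lt_ry hBs hrt
        rw [h0] at hβ'
        exact (pow_eq_zero_iff hp.out.ne_zero).mp hβ'.symm
      refine ⟨stepT p 0 β' (swapTY f), d - p, rt, true, 0, β', fun _ => ⟨fun h => absurd h (by decide),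
        fun _ => ⟨rfl, by rw [hdto], rfl, hγ0 rfl⟩⟩, fun h => absurd hhit h, ⟨E'', f', w'', hJ'', hw'', hE''⟩,
        lowVanish_succ_stepT hlow₁ hdeg hβ', ?_⟩
      have h := bdiv_stepT (l := (0 : K)) (γ := β') (lowVanish_swapTY hlowd) hBs hpd (by omega) hγ0
      rw [if_pos rfl] at h
      exact h
  · -- the thread point is not blown up: transport
    obtain ⟨ξ₀, -, -, hDξ₀⟩ := IsPermissibleCentre.exists_eq_singleton_of_isolatedSing (r.permissible k)
      ((regimeMohWindowSurfaceInsep_iff _ _).mp (hr k)).1.1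
    have hoff : (r.π k).base (t.y (k + 1)) ∉ (r.D k : Set (r.A k).Z) := by
      rw [hc, hDξ₀, Set.mem_singleton_iff]
      rintro rfl
      exact hhit hDξ₀
    obtain ⟨e', f', hJ', hE'⟩ := exists_formalAnchor_offCentre (E := r.E k) (r.π k) (r.blowup k) hoff e hJ _ hE
    refine ⟨f, rt, ry, false, 0, 0, fun h => absurd h hhit, fun _ => ⟨rfl, rfl, rfl⟩, ⟨e', f', w, ?_, hw, hE'⟩, hP2, hB⟩
    rw [r.E_succ k]; exact hJ'

end WWalk

end CampaignW46

end Summit.ResolutionOfSingularities.ResolutionOfSingularities.Theorems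

end
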